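import Literature.Geometry.Riemannian.BonnetMyers
import HarnessLib

/-!
# Hamilton 1982, Thm. 15.1: a gradient bound and `Rc ≥ εRg` force `R_min ≥ (1-η) R_max` (via Myers)
(topic `Geometry/Riemannian`)

Brick B3' of the convergence half (H1) of
`Literature.Geometry.Riemannian.hamilton_positiveCurvatureOperator_classification_four`
(`HamiltonPCOClassification.lean`; Hamilton 1986, Thm. 1.1, whose proof "proceeds as in [1]" =
Hamilton 1982 once the pinching estimate holds, §2, p. 154). The GEOMETRIC half of
**Hamilton 1982, Thm. 15.1** (J. Differential Geom. 17, p. 299: "`R_max/R_min → 1` as `t → T`"),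
separated from its PDE input (the gradient estimate Thm. 11.1) and stated for an arbitrary `C¹`
function `R` on a closed Riemannian manifold — verbatim the printed argument:

> "Then `|∂ᵢR| ≤ η²R_max^{3/2}` for `t ≥ θ`. Fix a point `x ∈ X` where `R` assumes its maximum.
> Then on any geodesic out of `x` of length at most `s = 1/(η R_max^{1/2})` we have
> `R ≥ (1-η)R_max`. We claim that when `η > 0` is small enough then this includes all of `X`.
> For `R_ij ≥ εRg_ij` for some `ε > 0`. It follows that every geodesic from `x` of length `s` has
> a conjugate point when `η` is small by the following well-known theorem of Myers [Thm. 15.2].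
> Thus we can reach every point of `X` by a geodesic of length at most `s`, and hence
> `R_min ≥ (1-η)R_max`."

* `abs_sub_le_mul_of_mfderiv_le` — a `C¹` function whose differential is bounded by `A|·|_g`
  changes by at most `A t` along a unit-speed geodesic `γ_u|[0, t]` (mean value inequality);
* `one_sub_mul_le_of_ricci_ge_of_mfderiv_le` — **Thm. 15.1, geometric step**: on a compact
  connected manifold of dimension `m ≥ 2` with a smooth Riemannian metric, if `R` attains its
  maximum `R_max > 0` at `x`, `|dR(w)| ≤ η² R_max^{3/2} |w|_g`, `Rc(w,w) ≥ ε R g(w,w)` with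
  `ε > 0`, `0 < η < 1` and `π²(m-1)η² < ε(1-η)` ("`η` small enough"), then `R ≥ (1-η)R_max`
  everywhere (Hopf–Rinow `exists_isMinimizingUpTo_of_isGeodesicallyComplete`, Myers' theorem
  `length_mul_sqrt_le_pi_of_isMinimizingUpTo` of `BonnetMyers.lean` = Hamilton's Thm. 15.2).

No definitions, no named facts (D-0026). The smallness condition is the explicit form of "when
`η > 0` is small enough": a geodesic of length `s = 1/(η√R_max)` along which
`Rc ≥ ε(1-η)R_max g = (m-1)k g` is longer than `π/√k` exactly when `π²(m-1)η² < ε(1-η)`.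

## References

* R. S. Hamilton, *Three-manifolds with positive Ricci curvature*, J. Differential Geom. 17
  (1982) 255–306, §15, Thm. 15.1 and Thm. 15.2 (p. 299). [Hamilton1982]
* R. S. Hamilton, *Four-manifolds with positive curvature operator*, J. Differential Geom. 24
  (1986) 153–179, §2, p. 154. [Hamilton1986]
* S. B. Myers, Duke Math. J. 8 (1941) 401–404. [Myers1941]
-/

noncomputable section

open Bundle Set Filter Function
open scoped Manifold ContDiff Topology

namespace Literature.Geometry.Riemannian

open Literature.Geometry.Lorentzian Literature.Geometry.Lorentzian.PseudoRiemannianMetric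

section Lipschitz

variable {E : Type*} [NormedAddCommGroup E] [NormedSpace ℝ E] [FiniteDimensional ℝ E]
  [CompleteSpace E] {M : Type*} [TopologicalSpace M] [ChartedSpace E M] [IsManifold 𝓘(ℝ, E) ∞ M]
  [T2Space M]
  (g : PseudoRiemannianMetric 𝓘(ℝ, E) ∞ E (TangentSpace 𝓘(ℝ, E) : M → Type _)) [g.HasLeviCivita]
  [CovariantDerivative.ContMDiffCovariantDerivative g.leviCivita 1]

/-- **A gradient bound controls the change of a function along a unit-speed geodesic** ("on any
geodesic out of `x` of length at most `s` we have `R ≥ (1-η)R_max`", Hamilton 1982, proof of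
Thm. 15.1): if `f` is `C¹` with `|df_y(w)| ≤ A |w|_g` for all tangent vectors, and `u ∈ T_pM` is
a unit vector, then `|f(γ_u(t)) - f(p)| ≤ A t` for `t ≥ 0` (chain rule `hasDerivAt_comp_curve`,
constant speed of geodesics, and the mean value inequality
`norm_image_sub_le_of_norm_deriv_le_segment'`). [cite: Hamilton1982, §15, Thm. 15.1 (proof)] -/
theorem abs_sub_le_mul_of_mfderiv_le (hc : IsGeodesicallyComplete g.leviCivita) {f : M → ℝ}
    (hf : ∀ y, MDifferentiableAt 𝓘(ℝ, E) 𝓘(ℝ, ℝ) f y) {A : ℝ}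
    (hA : ∀ (y : M) (w : TangentSpace 𝓘(ℝ, E) y),
      |(show ℝ from mfderiv 𝓘(ℝ, E) 𝓘(ℝ, ℝ) f y w)| ≤ A * Real.sqrt (g.val y w w))
    (p : M) (u : TangentSpace 𝓘(ℝ, E) p) (hu : g.val p u u = 1) {t : ℝ} (ht : 0 ≤ t) :
    |f (maximalGeodesic g.leviCivita p u t) - f p| ≤ A * t := by
  have hLC := PseudoRiemannianMetric.isLeviCivita_leviCivita_holds (g := g)
  obtain ⟨-, hgeo, hγ0, hγu⟩ := maximalGeodesic_of_isGeodesicallyComplete hc p u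
  -- unit speed
  have hspeed : ∀ s, g.val (maximalGeodesic g.leviCivita p u s)
      (velocity 𝓘(ℝ, E) (maximalGeodesic g.leviCivita p u) s)
      (velocity 𝓘(ℝ, E) (maximalGeodesic g.leviCivita p u) s) = 1 := by
    intro s
    rw [g.val_velocity_eq_of_isGeodesicOn_of_isCompatible hLC.2 isOpen_univ Set.ordConnected_univ
      hgeo (mem_univ s) (mem_univ 0), hγu]
    have : maximalGeodesic g.leviCivita p u 0 = p := hγ0
    rw [this]
    exact hu
  -- the derivative of `f ∘ γ_u` is bounded by `A`
  set F' : ℝ → ℝ := fun s ↦ (show ℝ from mfderiv 𝓘(ℝ, E) 𝓘(ℝ, ℝ) f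
    (maximalGeodesic g.leviCivita p u s) (velocity 𝓘(ℝ, E) (maximalGeodesic g.leviCivita p u) s))
    with hF'
  have hderiv : ∀ s, HasDerivAt (fun s ↦ f (maximalGeodesic g.leviCivita p u s)) (F' s) s := fun s ↦
    hasDerivAt_comp_curve (hf _) (mdifferentiableAt_of_mdifferentiableAt_lift (hgeo.1 s (mem_univ s)))
  have hbound : ∀ s ∈ Ico 0 t, ‖F' s‖ ≤ A := by
    intro s _
    have h := hA _ (velocity 𝓘(ℝ, E) (maximalGeodesic g.leviCivita p u) s)
    rw [hspeed s, Real.sqrt_one, mul_one] at h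
    rw [Real.norm_eq_abs]
    exact h
  have h := norm_image_sub_le_of_norm_deriv_le_segment' (fun s _ ↦ (hderiv s).hasDerivWithinAt)
    hbound t (right_mem_Icc.2 ht)
  rw [sub_zero, Real.norm_eq_abs] at h
  have h0 : maximalGeodesic g.leviCivita p u 0 = p := hγ0
  rwa [h0] at h

end Lipschitz

section RatioBound

variable {E : Type*} [NormedAddCommGroup E] [NormedSpace ℝ E] [FiniteDimensional ℝ E]
  [CompleteSpace E] {M : Type*} [TopologicalSpace M] [ChartedSpace E M] [IsManifold 𝓘(ℝ, E) ∞ M]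
  [T2Space M] [CompactSpace M] [ConnectedSpace M]
  (g : PseudoRiemannianMetric 𝓘(ℝ, E) ∞ E (TangentSpace 𝓘(ℝ, E) : M → Type _)) [g.HasLeviCivita]

/-- **Hamilton 1982, Thm. 15.1 (geometric step): `R_min ≥ (1-η)R_max`.** Let `M` be a compact
connected boundaryless manifold of dimension `m ≥ 2` with a smooth Riemannian metric `g`, and
`R : M → ℝ` a `C¹` function with `R_max := R(x) > 0` at a point `x` (in the source, the point
where `R` attains its maximum; maximality is not used by the argument). Suppose the gradient
bound `|dR_y(w)| ≤ η² R_max^{3/2} |w|_g` (the output of the gradient estimate, Thm. 11.1, at late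
times), the Ricci pinching `Rc_y(w, w) ≥ ε R(y) g_y(w, w)` with `ε > 0`, `0 < η < 1`, and the
smallness `π²(m-1)η² < ε(1-η)`. Then `R(y) ≥ (1-η)R_max` for every `y`. Proof as printed
(p. 299): along any unit-speed geodesic from `x`, `R ≥ R_max - η²R_max^{3/2} t ≥ (1-η)R_max` for
`t ≤ s = 1/(η√R_max)` (`abs_sub_le_mul_of_mfderiv_le`); join `y` to `x` by a minimizing geodesic
(Hopf–Rinow); if it were longer than `s`, its initial segment of length `s` would be minimizing
with `Rc ≥ ε(1-η)R_max g = (m-1)k g` along it, contradicting Myers' theorem (Thm. 15.2,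
`length_mul_sqrt_le_pi_of_isMinimizingUpTo`) since `s√k > π` by the smallness of `η`.
[cite: Hamilton1982, §15, Thm. 15.1] -/
theorem one_sub_mul_le_of_ricci_ge_of_mfderiv_le (hg : g.IsRiemannian)
    (hdim : 2 ≤ Module.finrank ℝ E) {R : M → ℝ} (hR : ∀ y, MDifferentiableAt 𝓘(ℝ, E) 𝓘(ℝ, ℝ) R y)
    {x : M} (hpos : 0 < R x) {η ε : ℝ} (hη : 0 < η) (hη1 : η < 1)
    (hε : 0 < ε)
    (hsmall : Real.pi ^ 2 * ((Module.finrank ℝ E : ℝ) - 1) * η ^ 2 < ε * (1 - η))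
    (hgrad : ∀ (y : M) (w : TangentSpace 𝓘(ℝ, E) y),
      |(show ℝ from mfderiv 𝓘(ℝ, E) 𝓘(ℝ, ℝ) R y w)| ≤ η ^ 2 * (R x * Real.sqrt (R x)) * Real.sqrt (g.val y w w))
    (hRic : ∀ (y : M) (w : TangentSpace 𝓘(ℝ, E) y),
      ε * R y * g.val y w w ≤ g.leviCivita.ricci y w w)
    (y : M) : (1 - η) * R x ≤ R y := by
  -- regularity package and completeness of the compact manifold
  have hLC := PseudoRiemannianMetric.isLeviCivita_leviCivita_holds (g := g)
  have hk1 : ((1 : ℕ∞) : ℕ∞ω) + 1 ≤ ∞ := by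
    rw [show ((1 : ℕ∞) : ℕ∞ω) + 1 = 2 by norm_num]
    exact WithTop.coe_le_coe.2 le_top
  haveI : CovariantDerivative.ContMDiffCovariantDerivative g.leviCivita 1 :=
    ⟨g.isLocallyContMDiff_leviCivita_holds 1 hk1 univ isOpen_univ⟩
  haveI : CovariantDerivative.ContMDiffCovariantDerivative g.leviCivita ∞ :=
    ⟨g.isLocallyContMDiff_leviCivita_holds ⊤ (le_of_eq rfl) univ isOpen_univ⟩
  have hc : IsGeodesicallyComplete g.leviCivita := hopfRinow_compact_geodesicallyComplete le_rfl hg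
  -- the constants
  set Rm := R x with hRm
  set m1 : ℝ := (Module.finrank ℝ E : ℝ) - 1 with hm1
  have hm1pos : 0 < m1 := by
    have : (2 : ℝ) ≤ (Module.finrank ℝ E : ℝ) := by exact_mod_cast hdim
    rw [hm1]; linarith
  have h1η : 0 < 1 - η := by linarith
  set sR := Real.sqrt Rm with hsR
  have hsR0 : 0 < sR := Real.sqrt_pos.2 hpos
  have hsq : sR ^ 2 = Rm := Real.sq_sqrt hpos.le
  set A := η ^ 2 * (Rm * sR) with hA
  have hA0 : 0 ≤ A := by positivity
  set s := 1 / (η * sR) with hs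
  have hs0 : 0 < s := by positivity
  have hAs : A * s = η * Rm := by
    rw [hA, hs]
    field_simp
  -- the estimate along unit-speed geodesics from `x`
  have hlow : ∀ (u : TangentSpace 𝓘(ℝ, E) x), g.val x u u = 1 → ∀ t, 0 ≤ t →
      Rm - A * t ≤ R (maximalGeodesic g.leviCivita x u t) := by
    intro u hu t ht
    have h := abs_sub_le_mul_of_mfderiv_le g hc hR hgrad x u hu ht
    rw [abs_le] at h
    linarith [h.1]
  -- a minimizing geodesic from `x` to `y`
  obtain ⟨v, hmin, hyv⟩ := exists_isMinimizingUpTo_of_isGeodesicallyComplete g le_rfl hg hc x y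
  have hvv0 : 0 ≤ g.val x v v := by
    by_cases hv : v = 0
    · simp [hv]
    · exact (hg x v hv).le
  set ℓ := Real.sqrt (g.val x v v) with hℓ
  rcases (show 0 ≤ ℓ from Real.sqrt_nonneg _).eq_or_lt with hℓ0 | hℓpos
  · -- `y = x`
    have hv0 : v = 0 := by
      by_contra hv
      have h1 : 0 < g.val x v v := hg x v hv
      have h2 : 0 < ℓ := Real.sqrt_pos.2 h1
      linarith
    have hyx : y = x := by
      rw [← hyv, hv0]
      exact riemannianExpMap_zero g x
    rw [hyx]
    nlinarith
  -- unit-speed reparametrisation `u = ℓ⁻¹ v`: minimizing up to `ℓ`, ending at `y`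
  have hvv : g.val x v v = ℓ ^ 2 := (Real.sq_sqrt hvv0).symm
  set u : TangentSpace 𝓘(ℝ, E) x := ℓ⁻¹ • v with hu'
  have hu : g.val x u u = 1 := by
    have h1 : g.val x u u = ℓ⁻¹ * ℓ⁻¹ * g.val x v v := by
      rw [hu']
      simp only [map_smul, FunLike.coe_smul, Pi.smul_apply, smul_eq_mul]
      ring
    rw [h1, hvv]
    field_simp
  have hminu : IsMinimizingUpTo g hg x u ℓ := by
    rw [hu', isMinimizingUpTo_smul_iff hg hc x v (inv_pos.2 hℓpos), inv_mul_cancel₀ hℓpos.ne']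
    exact hmin
  have hγℓ : maximalGeodesic g.leviCivita x u ℓ = y := by
    rw [hu', maximalGeodesic_smul hc x v ℓ⁻¹ ℓ, inv_mul_cancel₀ hℓpos.ne', ← hyv]
    exact (expMap_eq_maximalGeodesic hc x v).symm
  -- the speed of `γ_u`
  obtain ⟨-, hgeo, hγ0, hγu⟩ := maximalGeodesic_of_isGeodesicallyComplete hc x u
  have hspeed : ∀ t, g.val (maximalGeodesic g.leviCivita x u t)
      (velocity 𝓘(ℝ, E) (maximalGeodesic g.leviCivita x u) t)
      (velocity 𝓘(ℝ, E) (maximalGeodesic g.leviCivita x u) t) = 1 := by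
    intro t
    rw [g.val_velocity_eq_of_isGeodesicOn_of_isCompatible hLC.2 isOpen_univ Set.ordConnected_univ
      hgeo (mem_univ t) (mem_univ 0), hγu]
    have : maximalGeodesic g.leviCivita x u 0 = x := hγ0
    rw [this]
    exact hu
  -- the length is at most `s`, by Myers
  have hℓs : ℓ ≤ s := by
    by_contra hlt
    push Not at hlt
    have hmins : IsMinimizingUpTo g hg x u s := hminu.mono hc hs0.le hlt.le
    set k := ε * (1 - η) * Rm / m1 with hk
    have hk0 : 0 < k := by positivity
    have hRic' : ∀ t ∈ Ioo 0 s, ((Module.finrank ℝ E : ℝ) - 1) * k ≤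
        g.leviCivita.ricci (maximalGeodesic g.leviCivita x u t)
          (velocity 𝓘(ℝ, E) (maximalGeodesic g.leviCivita x u) t)
          (velocity 𝓘(ℝ, E) (maximalGeodesic g.leviCivita x u) t) := by
      intro t ht
      have h1 : (1 - η) * Rm ≤ R (maximalGeodesic g.leviCivita x u t) := by
        have h2 := hlow u hu t ht.1.le
        have h3 : A * t ≤ A * s := mul_le_mul_of_nonneg_left ht.2.le hA0
        rw [hAs] at h3
        linarith
      have h2 := hRic _ (velocity 𝓘(ℝ, E) (maximalGeodesic g.leviCivita x u) t)
      rw [hspeed t, mul_one] at h2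
      have h4 : m1 * k = ε * ((1 - η) * Rm) := by
        rw [hk]
        field_simp
      calc ((Module.finrank ℝ E : ℝ) - 1) * k = m1 * k := by rw [hm1]
        _ = ε * ((1 - η) * Rm) := h4
        _ ≤ ε * R (maximalGeodesic g.leviCivita x u t) := mul_le_mul_of_nonneg_left h1 hε.le
        _ ≤ _ := h2
    have hmy := length_mul_sqrt_le_pi_of_isMinimizingUpTo g hg hdim hc x u hu hk0 hs0 hmins hRic'
    -- but `s √k > π`
    have hsk : (s * Real.sqrt k) ^ 2 = ε * (1 - η) / (η ^ 2 * m1) := by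
      rw [mul_pow, Real.sq_sqrt hk0.le, hs, hk, div_pow, one_pow, mul_pow, hsq]
      field_simp
    have hπ : Real.pi ^ 2 < (s * Real.sqrt k) ^ 2 := by
      rw [hsk, lt_div_iff₀ (by positivity)]
      calc Real.pi ^ 2 * (η ^ 2 * m1) = Real.pi ^ 2 * m1 * η ^ 2 := by ring
        _ < ε * (1 - η) := hsmall
    have hcontra : Real.pi < s * Real.sqrt k := lt_of_pow_lt_pow_left₀ 2 (by positivity) hπ
    linarith
  -- conclusion along `γ_u|[0, ℓ]`
  have h1 := hlow u hu ℓ hℓpos.le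
  have h2 : A * ℓ ≤ A * s := mul_le_mul_of_nonneg_left hℓs hA0
  rw [hAs] at h2
  rw [← hγℓ]
  linarith

end RatioBound

end Literature.Geometry.Riemannian

end
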